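import Literature.Probability.Percolation.UniformPercolation
import HarnessLib

/-!
# Pointwise bound of the truncated two-point function by the truncated one-arm probability

Route `PercRayRenewal`, item `JumpLineAvoidanceDecay` (stmt-CriticalPhenomena-4626), helper file:
the pointwise engine converting decay of the truncated one-arm probability
`π^f_k = P_p({0 ↔ ∂Λ_k in Λ_k} ∖ {0 ↔ ∞})` into decay of the connected two-point function
`τ_p(0, x) - θ(p)²`. For nearest-neighbour bond percolation on `ℤ^d` (every `d`, every
`p ∈ [0, 1]`, every `k`) and every `x ∉ Λ_{2k}`,

`τ_p(0, x) - θ² ≤ 3 π^f_k`.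

Proof. Write `A_y = {|C(y)| = ∞}`, `B_y = {y ↔ y + ∂Λ_k in y + Λ_k}` (the translated one-arm event
`DCT16.armEvent y k`), `g = P_p(0 ↔ ∂Λ_k)`, `θ = θ(p)`. For a lattice configuration `ω ⊆ E(ℤ^d)`
(almost every configuration),
`{0 ↔ x} ⊆ (A_0 ∩ A_x) ∪ (B_0 ∖ A_0)`:
if `0 ↔ x` and `|C(0)| = ∞` then `C(x) = C(0)` is infinite; if `0 ↔ x` and `|C(0)| < ∞` then the
open path from `0` to `x ∉ Λ_k` leaves `Λ_k` through `∂Λ_k` (first exit), so `B_0` holds.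
Moreover `A_y ⊆ B_y` (an infinite cluster leaves every finite box), the events `B_0`, `B_x` depend
on the bonds of the disjoint boxes `Λ_k`, `x + Λ_k` (disjoint because `x ∉ Λ_{2k}`), hence are
independent with `P_p(B_0) = P_p(B_x) = g` (translation invariance), and `P_p(B_0 ∖ A_0) = g - θ
= π^f_k` (`A_0 ⊆ B_0` a.s.). Therefore `τ_p(0, x) ≤ g² + (g - θ)` and, using `0 ≤ θ ≤ g ≤ 1`,
`τ_p(0, x) - θ² ≤ (g - θ)(g + θ) + (g - θ) = (g - θ)(g + θ + 1) ≤ 3 (g - θ)`.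

## References

* G. Grimmett, *Percolation*, 2nd ed., Grundlehren 321, Springer 1999, §8.5 p. 213 (the split
  `τ_p(x, y) = τ^f_p(x, y) + P_p(x, y in infinite open clusters)`), §1.4 (`θ(p) ≤ P_p(0 ↔ ∂B(n))`),
  §2.2 (events depending on disjoint edge sets are independent) [GrimmettPercolation1999].
-/

noncomputable section

namespace Summit.CriticalPhenomena.PercolationContinuityZ3.Theorems

open MeasureTheory Literature.Probability.Percolation Literature.Probability.LatticeModels
open Literature.Probability.Percolation.DCT16

namespace TwoPointPointwise

/-- Percolation is a class property: if `u ↔ v` and `|C(u)| = ∞` then `|C(v)| = ∞`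
(indeed `C(v) = C(u)`). [folklore] -/
theorem percolatesAt_of_reachable {V : Type*} {ω : BondConfig V} {u v : V}
    (h : (openGraph ω).Reachable u v) (hu : ω ∈ percolatesAt u) : ω ∈ percolatesAt v := by
  have hC : openCluster ω v = openCluster ω u :=
    Set.ext fun _ => ⟨fun hy => h.trans hy, fun hy => h.symm.trans hy⟩
  show (openCluster ω v).Infinite
  rw [hC]
  exact hu

/-- **The cover of the two-point event.** For a lattice configuration `ω ⊆ E(ℤ^d)` and
`x ∉ Λ_k`: if `0 ↔ x` then either both `|C(0)| = ∞` and `|C(x)| = ∞`, whence both one-arm events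
`0 ↔ ∂Λ_k`, `x ↔ x + ∂Λ_k` hold, or `|C(0)| < ∞` and the open path from `0` to `x` produces the
arm `0 ↔ ∂Λ_k` (first exit from `Λ_k`). [folklore] -/
theorem openConn_subset_of_subset_edgeSet {d k : ℕ} {x : Site d} (hxk : x - 0 ∉ box d k)
    {ω : BondConfig (Site d)} (hω : ω ⊆ (zdGraph d).edgeSet) (hconn : ω ∈ openConn (0 : Site d) x) :
    ω ∈ (armEvent (0 : Site d) k ∩ armEvent x k) ∪ (armEvent (0 : Site d) k \ percolatesAt 0) := by
  by_cases h0 : ω ∈ percolatesAt (0 : Site d)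
  · exact Or.inl ⟨armEvent_of_percolatesAt hω h0,
      armEvent_of_percolatesAt hω (percolatesAt_of_reachable hconn h0)⟩
  · exact Or.inr ⟨armEvent_of_pathIn hω (pathIn_univ_of_reachable hconn) (Or.inl hxk), h0⟩

/-- **`P_p(0 ↔ x) ≤ g² + (g - θ)`** for `x ∉ Λ_{2k}`, where `g = P_p(0 ↔ ∂Λ_k)`: union bound on the
cover `openConn_subset_of_subset_edgeSet`, independence of the one-arm events of the disjoint boxes
`Λ_k` and `x + Λ_k` with `P_p(x ↔ x + ∂Λ_k) = g` (translation invariance), and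
`P_p({0 ↔ ∂Λ_k} ∖ {0 ↔ ∞}) = g - θ`. [folklore] -/
theorem real_openConn_le {d : ℕ} (p : unitInterval) {k : ℕ} {x : Site d} (hx : x ∉ box d (2 * k)) :
    (bondPercolation (zdGraph d) p).real (openConn (0 : Site d) x) ≤
      (bondPercolation (zdGraph d) p).real (siteToBoundary d k) *
          (bondPercolation (zdGraph d) p).real (siteToBoundary d k) +
        ((bondPercolation (zdGraph d) p).real (siteToBoundary d k) - theta (zdGraph d) 0 p) := by
  have hx0 : x - 0 ∉ box d (2 * k) := by rwa [sub_zero]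
  have hxk : x - 0 ∉ box d k := fun h => hx0 (box_mono d (by omega) h)
  -- independence of the one-arm events of the two disjoint boxes
  have hind : (bondPercolation (zdGraph d) p).real (armEvent (0 : Site d) k ∩ armEvent x k) =
      (bondPercolation (zdGraph d) p).real (siteToBoundary d k) *
        (bondPercolation (zdGraph d) p).real (siteToBoundary d k) := by
    rw [bondPercolation_real_inter_of_disjoint (zdGraph d) p (disjoint_sym2_shiftedBox hx0)
      (determinedBy_zdArmEvent 0 k) (determinedBy_zdArmEvent x k) (measurableSet_zdArmEvent 0 k)
      (measurableSet_zdArmEvent x k), real_armEvent, real_armEvent]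
  calc (bondPercolation (zdGraph d) p).real (openConn (0 : Site d) x)
      ≤ (bondPercolation (zdGraph d) p).real
          ((armEvent (0 : Site d) k ∩ armEvent x k) ∪ (armEvent (0 : Site d) k \ percolatesAt 0)) :=
        real_mono_of_forall_subset_edgeSet (zdGraph d) p fun _ hω hconn =>
          openConn_subset_of_subset_edgeSet hxk hω hconn
    _ ≤ (bondPercolation (zdGraph d) p).real (armEvent (0 : Site d) k ∩ armEvent x k) +
          (bondPercolation (zdGraph d) p).real (armEvent (0 : Site d) k \ percolatesAt 0) :=
        measureReal_union_le _ _
    _ = _ := by rw [hind, real_armEvent_diff_percolatesAt p 0 k]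

end TwoPointPointwise

open TwoPointPointwise in
/-- **Pointwise bound of the truncated two-point function by the truncated one-arm probability**
(engine of the two-point form of the void-decay statement): for bond percolation on `ℤ^d`, every
`d`, every `p ∈ [0, 1]`, every `k` and every `x ∉ Λ_{2k}`,
`τ_p(0, x) - θ(p)² ≤ 3 P_p({0 ↔ ∂Λ_k} ∖ {0 ↔ ∞})`.
From `τ_p(0, x) ≤ g² + (g - θ)` (`TwoPointPointwise.real_openConn_le`, `g = P_p(0 ↔ ∂Λ_k)`) and
`0 ≤ θ ≤ g ≤ 1`: `τ - θ² ≤ (g - θ)(g + θ + 1) ≤ 3 (g - θ)`, and `g - θ = P_p({0 ↔ ∂Λ_k} ∖ {0 ↔ ∞})`.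
[folklore] -/
theorem real_openConn_sub_sq_le_three_mul_truncArm {d : ℕ} (p : unitInterval) {k : ℕ} {x : Site d}
    (hx : x ∉ box d (2 * k)) :
    (bondPercolation (zdGraph d) p).real (openConn (0 : Site d) x) - theta (zdGraph d) (0 : Site d) p ^ 2 ≤
      3 * (bondPercolation (zdGraph d) p).real (siteToBoundary d k \ percolatesAt 0) := by
  have hle := real_openConn_le p hx
  have htrunc : (bondPercolation (zdGraph d) p).real (siteToBoundary d k \ percolatesAt 0) =
      (bondPercolation (zdGraph d) p).real (siteToBoundary d k) - theta (zdGraph d) 0 p := by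
    rw [← real_armEvent_diff_percolatesAt p 0 k, armEvent_zero]
  have hθg : theta (zdGraph d) 0 p ≤ (bondPercolation (zdGraph d) p).real (siteToBoundary d k) :=
    theta_le_real_siteToBoundary p k
  have hg1 : (bondPercolation (zdGraph d) p).real (siteToBoundary d k) ≤ 1 := measureReal_le_one
  have hθ0 : 0 ≤ theta (zdGraph d) (0 : Site d) p := measureReal_nonneg
  rw [htrunc]
  nlinarith [mul_nonneg (sub_nonneg.2 hθg)
    (show (0 : ℝ) ≤ 2 - (bondPercolation (zdGraph d) p).real (siteToBoundary d k) -
      theta (zdGraph d) 0 p by linarith)]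

end Summit.CriticalPhenomena.PercolationContinuityZ3.Theorems

end
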